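import Literature.AlgebraicGeometry.Resolution.GeneralizedStabilityLemma55VT
import Literature.AlgebraicGeometry.Resolution.HenselizationHenselian
import Literature.AlgebraicGeometry.Resolution.HenselizationImmediateProofs
import Literature.AlgebraicGeometry.Resolution.HenselLift
import Mathlib.FieldTheory.KummerExtension
import Mathlib.RingTheory.RootsOfUnity.AlgebraicallyClosed
import HarnessLib

/-!
# Tame extensions of `K(x)^h`: roots of `1`-units, the prime-to-`p` cyclic step, and Lemma 2.27 (Kuhlmann 2010, §2.2, §2.5, §5)

Topic: `Literature/AlgebraicGeometry/Resolution` (valued function fields). Second layer (after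
`NormalDegreePDefectlessVT.lean`) of the decomposition of the named fact
`Kuhlmann2010HenselizedRationalImmediateExt` (`GeneralizedStabilityHenselizedRational.lean`) =
the italicized statement on p. 19 of F.-V. Kuhlmann, *Elimination of ramification I: The
generalized stability theorem*, Trans. AMS 362 (2010) 5697–5727 = arXiv:1003.5678 ("*Henselized
inertially generated function fields of rank 1 and of transcendence degree 1 with a
valuation-transcendental generator over an algebraically closed ground field do not admit proper
immediate algebraic extensions*"), for `F = K(x)^h` with a value-transcendental generator. The
printed proof (pp. 18–19) passes through the absolute ramification field `F^r`:

> Since the ramification group is a `p`-group (cf. [En]), `F^sep|F^r` is a `p`-extension. …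
> Then there is already a finite subextension `N|F` of `F^r|F` such that `E.N|N` is such a
> tower. Lemma 2.27 shows that `N`, being a finite subextension inside `F^r`, is again a
> henselized inertially generated function field of transcendence degree 1 with a
> valuation-transcendental generator over `K`.

This file PROVES, from Hensel's Lemma for henselian fields (the named fact
`Kuhlmann2010HenselsLemma` of `HenselLift.lean`, §1.1: "henselian … if and only if `(K,v)`
satisfies Hensel's Lemma"), the two pieces of TAME ramification theory that the finite-level
assembly of the italicized statement (`HenselizedRationalImmediateExtProofs.lean`) uses in place
of `F^r`:

* the prime-to-`p` step behind "the ramification group is a `p`-group": a Galois extension of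
  prime degree `ℓ ≠ char K̄` of a henselian field `M ⊇ K` with residue field `K̄` (`K`
  algebraically closed) has ramification index `ℓ` (Kummer generator `α`, `α^ℓ ∈ M`; were
  `v(α) ∈ vM`, Hensel's Lemma — §2.2: "in every henselian field, each `1`-unit … is an `n`-th
  power for every `n` not divisible by the residue characteristic `p`" — would put `α` in `M`);
* **Lemma 2.27** (value-transcendental case): a finite TAME extension of `K(x)^h` is again
  `K(y)^h` with `y` value-transcendental.

## Content (everything PROVED)

* `exists_pow_eq_of_valuation_sub_one_lt` — `n`-th roots of `1`-units in a subfield whose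
  valuation ring satisfies Hensel's Lemma, `n ≠ 0` in the residue field (§2.2).
* `mem_of_isAlgebraic_of_isAlgClosed`, `mem_of_pow_eq_one_of_isAlgClosed`,
  `exists_isPrimitiveRoot_mem_of_isAlgClosed`, `resField_le_of_forall_isAlgebraic`,
  `exists_mem_valuation_div_sub_one_lt` — bookkeeping over an algebraically closed ground field
  `K ≤ Ω`: algebraic elements and roots of unity of `Ω` lie in `K`, residues of algebraic
  extensions lie in `Kv` (Lemma 2.1), units with residue in `Kv` are `K`-multiples of `1`-units.
* `relRamificationIndex_eq_of_isGalois_prime` — **the tame step**: `e(N|M) = ℓ` for `N|M`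
  Galois of prime degree `ℓ ≠ char Ωv` over a henselian `M ⊇ K` with `Nv ⊆ Kv` (Kummer theory,
  Mathlib's `exists_root_adjoin_eq_top_of_isCyclic`, and Hensel's Lemma).
* `relRamificationIndex_eq_one_of_forall` — `e(N|M) = 1` when every value of `N` is a value of
  `M`.
* `exists_eq_henselizedAdjoin_of_tame` — **Lemma 2.27, Case I**: for `K` algebraically closed,
  `x` value-transcendental, `E ≥ K(x)^h` finite with `[E : K(x)^h] = e(E|K(x)^h)` not divisible
  by the residue characteristic, `E = K(y)^h` for a value-transcendental `y ∈ E` (with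
  `y^{n} = c x`, `c ∈ K`, as printed).

## Sources

* F.-V. Kuhlmann, *Elimination of ramification I: The generalized stability theorem*, Trans.
  Amer. Math. Soc. 362 (2010) 5697–5727 = arXiv:1003.5678: §1.1 (henselian fields, Hensel's
  Lemma), Lemma 2.1, Lemma 2.2, Lemma 2.5, §2.2 (roots of `1`-units), §2.5 (henselized rational
  function fields; Lemmas 2.26–2.27), §5 (proof of (R4), pp. 18–19).
* Kummer theory: Mathlib (`Mathlib.FieldTheory.KummerExtension`), in place of [L] = S. Lang,
  *Algebra*, Thm. VI.6.2 cited by the source (§4).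

## Rendering notes

* As in `GeneralizedStabilityRankOneVTPairs.lean`: one valued field `(Ω, V)` (algebraically
  closed where needed), fields = `Subfield Ω`, pairs `M ≤ N` with the inclusion algebra and the
  invariants `relRamificationIndex`, `relInertiaDegree`, `relFinrank`, `RelFinite`.
* "`E ⊂ F^r`" in Lemma 2.27 is rendered by exactly what the printed proof uses of it — "Since
  `E ⊂ F^r`, `n` is equal to `[E:F]` and prime to `char K̄`": `[E : F] = e(E|F)` and `[E : F] ≠ 0`
  in the residue field (for a henselian `F` with algebraically closed residue field these are the
  finite subextensions of `F^r|F`, by general ramification theory, which is not needed here).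
* The value `v(x)/n` of the printed proof is realised, as in the proof of Lemma 5.5
  (`GeneralizedStabilityLemma55VT.lean`), by an `x' ∈ E` admitting the MAXIMAL exponent `n₀` with
  `v(x')^{n₀} ≡ v(x)` modulo `vK`; then `vE ⊆ vK·⟨vx'⟩`, `n₀ ∣ e(E|F)`, and the final squeeze uses
  `e(E|F) = [E : F]` in the form `[E : K(y)^h] = 1`.
* Hensel's Lemma enters only through `Kuhlmann2010HenselsLemma` (hypothesis `hHL`); "the
  henselization is henselian / immediate" are the PROVED `…_holds` theorems.
-/

noncomputable section

open IsLocalRing Polynomial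

namespace Literature.AlgebraicGeometry.Resolution

universe u

variable {Ω : Type u} [Field Ω] (V : ValuationSubring Ω)

/-! ### Roots of `1`-units by Hensel's Lemma -/

section HenselRoots

/-- Membership in the maximal ideal of `V ∩ M` is `v < 1`. [folklore] -/
theorem mem_maximalIdeal_comap_subfield_iff (M : Subfield Ω) (c : V.comap (algebraMap M Ω)) :
    c ∈ maximalIdeal (V.comap (algebraMap M Ω)) ↔ V.valuation ((c : M) : Ω) < 1 := by
  rw [← residueHom_eq_zero_iff, residueHom_apply, residue_eq_zero_iff,
    ValuationSubring.valuation_lt_one_iff]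

/-- **`n`-th roots of `1`-units in a henselian field** (Kuhlmann 2010, §2.2: "A well known
application of Hensel's Lemma shows that in every henselian field, each `1`-unit (an element of
the form `1+b` with `vb>0`) is an `n`-th power for every `n` not divisible by the residue
characteristic `p`"): inside `(Ω, V)`, if the valuation ring `V ∩ M` of the subfield `M`
satisfies Hensel's Lemma, `n` is not divisible by the residue characteristic and `u ∈ M` has
`v(u - 1) < 1`, then `u = wⁿ` for a `1`-unit `w ∈ M`. PROVED (Hensel's Lemma for `Xⁿ - u` at
the approximate root `1`). [cite: Kuhlmann2010, Section 2.2] -/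
theorem exists_pow_eq_of_valuation_sub_one_lt {M : Subfield Ω}
    (hM : HenselianLocalRing (V.comap (algebraMap M Ω))) {n : ℕ}
    (hn : (n : ResidueField V) ≠ 0) {u : Ω} (huM : u ∈ M) (hu : V.valuation (u - 1) < 1) :
    ∃ w ∈ M, w ^ n = u ∧ V.valuation (w - 1) < 1 := by
  haveI := hM
  set O := V.comap (algebraMap M Ω) with hO
  -- `u` is a unit of `V`
  have hu1 : V.valuation u = 1 := by
    have h := Valuation.map_add_eq_of_lt_left V.valuation (x := (1 : Ω)) (y := u - 1)
      (by rw [Valuation.map_one]; exact hu)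
    rw [add_sub_cancel, Valuation.map_one] at h
    exact h
  have huV : u ∈ V := (V.valuation_le_one_iff u).mp hu1.le
  set uO : O := ⟨⟨u, huM⟩, huV⟩ with huO
  set f : Polynomial O := X ^ n - C uO with hf
  have hn0 : n ≠ 0 := by
    rintro rfl
    exact hn (by simp)
  have hmonic : f.Monic := monic_X_pow_sub_C uO hn0
  have h1 : f.eval 1 ∈ maximalIdeal O := by
    rw [mem_maximalIdeal_comap_subfield_iff]
    have : f.eval 1 = 1 - uO := by simp [hf]
    rw [this]
    change V.valuation ((1 : Ω) - u) < 1
    rw [← Valuation.map_neg, neg_sub]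
    exact hu
  have h2 : IsUnit (f.derivative.eval 1) := by
    have hder : f.derivative.eval 1 = (n : O) := by
      simp [hf, derivative_X_pow]
    rw [hder]
    by_contra hnu
    have hmem : (n : O) ∈ maximalIdeal O := (IsLocalRing.mem_maximalIdeal _).mpr hnu
    rw [← residueHom_eq_zero_iff, map_natCast] at hmem
    exact hn hmem
  obtain ⟨a, ha, ha1⟩ := HenselianLocalRing.is_henselian f hmonic 1 h1 h2
  refine ⟨((a : M) : Ω), (a : M).2, ?_, ?_⟩
  · have h3 : a ^ n = uO := by
      have := ha.eq_zero
      simp only [hf, eval_sub, eval_pow, eval_X, eval_C] at this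
      exact sub_eq_zero.mp this
    have := congrArg (fun z : O => (((z : M) : Ω))) h3
    simpa using this
  · have h4 := (mem_maximalIdeal_comap_subfield_iff V M _).mp ha1
    simpa using h4

end HenselRoots

/-! ### Algebraically closed ground fields: algebraic elements, roots of unity, residues -/

section AlgClosedGround

variable {V}

/-- An element of `Ω` algebraic over an algebraically closed subfield `K` lies in `K` (its
minimal polynomial is irreducible, hence linear). [folklore] -/
theorem mem_of_isAlgebraic_of_isAlgClosed {K : Subfield Ω} (hK : IsAlgClosed K) {z : Ω}
    (hz : IsAlgebraic K z) : z ∈ K := by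
  haveI := hK
  have hdeg := IsAlgClosed.degree_eq_one_of_irreducible K (minpoly.irreducible hz.isIntegral)
  obtain ⟨c, hc⟩ := minpoly.mem_range_of_degree_eq_one K z hdeg
  rw [← hc]
  exact c.2

/-- Roots of unity of `Ω` lie in every algebraically closed subfield `K`. [folklore] -/
theorem mem_of_pow_eq_one_of_isAlgClosed {K : Subfield Ω} (hK : IsAlgClosed K) {z : Ω} {n : ℕ}
    (hn : n ≠ 0) (hz : z ^ n = 1) : z ∈ K := by
  refine mem_of_isAlgebraic_of_isAlgClosed hK ⟨X ^ n - 1, ?_, ?_⟩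
  · exact (monic_X_pow_sub_C (1 : K) hn).ne_zero
  · simp [hz]

/-- An algebraically closed subfield `K ≤ Ω` contains a primitive `n`-th root of unity for every
`n` not divisible by the characteristic. [folklore] -/
theorem exists_isPrimitiveRoot_mem_of_isAlgClosed {K : Subfield Ω} (hK : IsAlgClosed K) {n : ℕ}
    (hn : (n : Ω) ≠ 0) : ∃ ζ ∈ K, IsPrimitiveRoot ζ n := by
  haveI := hK
  haveI : NeZero ((n : ℕ) : K) := ⟨fun h => hn (by
    have := congrArg (fun c : K => (c : Ω)) h
    simpa using this)⟩
  obtain ⟨ζ, hζ⟩ := HasEnoughRootsOfUnity.exists_primitiveRoot K n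
  exact ⟨ζ, ζ.2, hζ.map_of_injective (algebraMap K Ω).injective⟩

variable (V)

/-- **Residues of algebraic extensions stay in `Kv`**: if every element of the subfield `N` is
algebraic over a subfield `K'` whose residues lie in the residue field `Kv` of an algebraically
closed subfield `K`, then `Nv ≤ Kv` (residues of algebraic elements are algebraic over `K'v`,
and `Kv` is algebraically closed with `K`, Kuhlmann 2010, Lemma 2.1). PROVED.
[cite: Kuhlmann2010, Lemma 2.1] -/
theorem resField_le_of_forall_isAlgebraic {K K' N : Subfield Ω} (hK : IsAlgClosed K)
    (hres : resField V K' ≤ resField V K) (halg : ∀ a ∈ N, IsAlgebraic K' a) :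
    resField V N ≤ resField V K := by
  haveI := hK
  intro r hr
  obtain ⟨a, haN, rfl⟩ := (mem_resField_iff V N r).mp hr
  obtain ⟨p, hp0, hpa⟩ := halg a haN
  have hP0 : p.map (algebraMap K' Ω) ≠ 0 :=
    (Polynomial.map_ne_zero_iff (algebraMap K' Ω).injective).mpr hp0
  have hPc : ∀ k, (p.map (algebraMap K' Ω)).coeff k ∈ K' := fun k => by
    rw [Polynomial.coeff_map]; exact (p.coeff k).2
  have hPa : (p.map (algebraMap K' Ω)).eval (a : Ω) = 0 := by
    rw [Polynomial.eval_map, ← Polynomial.aeval_def]; exact hpa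
  have h1 : IsAlgebraic (resField V K') (residue V ⟨(a : Ω), a.2⟩) :=
    isAlgebraic_residue_of_eval_eq_zero V K' hP0 hPc a.2 hPa
  have h2 : IsAlgebraic (resField V K) (residue V a) := isAlgebraic_of_subfield_le hres h1
  haveI : IsAlgClosed (resField V K) := isAlgClosed_resField_of_isAlgClosed V K
  have hdeg := IsAlgClosed.degree_eq_one_of_irreducible (resField V K)
    (minpoly.irreducible h2.isIntegral)
  obtain ⟨r', hr'⟩ := minpoly.mem_range_of_degree_eq_one (resField V K) _ hdeg
  rw [← hr']
  exact r'.2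

/-- A unit of `V` whose residue lies in `Kv` is `c · (1-unit)` for a unit `c ∈ K`: there is
`c ∈ K` with `v(c) = 1` and `v(u/c - 1) < 1`. [folklore] -/
theorem exists_mem_valuation_div_sub_one_lt {K : Subfield Ω} {u : Ω} (hu : V.valuation u = 1)
    (hres : residue V ⟨u, (V.valuation_le_one_iff u).mp hu.le⟩ ∈ resField V K) :
    ∃ c ∈ K, V.valuation c = 1 ∧ V.valuation (u / c - 1) < 1 := by
  obtain ⟨c, hcK, hc⟩ := (mem_resField_iff V K _).mp hres
  have huV : u ∈ V := (V.valuation_le_one_iff u).mp hu.le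
  have hune : residue V ⟨u, huV⟩ ≠ 0 := by
    rw [Ne, residue_eq_zero_iff, ValuationSubring.valuation_lt_one_iff]
    exact fun h => h.ne hu
  have hcne : residue V c ≠ 0 := by rw [hc]; exact hune
  have hc1 : V.valuation (c : Ω) = 1 := by
    have hle : V.valuation (c : Ω) ≤ 1 := (V.valuation_le_one_iff _).mpr c.2
    rcases hle.lt_or_eq with h | h
    · exact absurd ((residue_eq_zero_iff c).mpr ((V.valuation_lt_one_iff c).mpr h)) hcne
    · exact h
  have hc0 : (c : Ω) ≠ 0 := fun h => by rw [h, map_zero] at hc1; exact zero_ne_one hc1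
  refine ⟨c, hcK, hc1, ?_⟩
  -- `u/c - 1 = (u - c)/c` has value `v(u - c) < 1`
  have hsub : V.valuation (u - c) < 1 := by
    have : residue V (⟨u, huV⟩ - c) = 0 := by rw [map_sub, hc, sub_self]
    rw [residue_eq_zero_iff, ValuationSubring.valuation_lt_one_iff] at this
    simpa using this
  have : u / c - 1 = (u - c) / c := by field_simp
  rw [this, map_div₀, hc1, div_one]
  exact hsub

end AlgClosedGround

/-! ### Cyclic extensions of prime degree `ℓ ≠ p` of henselian fields are totally ramified -/

section TameStep

variable {V}

/-- **A Galois extension of prime degree `ℓ ≠ char Kv` of a henselian field with residue field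
`Kv` (`K` algebraically closed) has ramification index `ℓ`** — the computation behind "the
ramification group is a `p`-group" (Kuhlmann 2010, §1.1 and §5, p. 18, "cf. [En]"): by Kummer
theory `N = M(α)` with `α^ℓ ∈ M` (`K ⊆ M` contains the `ℓ`-th roots of unity); if `v(α)` were
a value of `M`, then `α = c · c' · (1-unit)` with `c ∈ M`, `c' ∈ K`, and the `1`-unit, an `ℓ`-th
root of the `1`-unit `α^ℓ/(c c')^ℓ ∈ M`, would lie in `M` up to an `ℓ`-th root of unity by
Hensel's Lemma in `M` — forcing `α ∈ M`. So the class of `v(α)` has order `ℓ` in `vN/vM`, and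
`e = (vN:vM) = ℓ` (`e ≤ [N:M] = ℓ`). Inside `(Ω, V)`: `K ≤ M ≤ N` subfields, `K` algebraically
closed, `V ∩ M` henselian (Hensel's Lemma), `Nv ≤ Kv`, `N|M` Galois of prime degree `ℓ` with
`ℓ ≠ 0` in `Ωv`. PROVED. [cite: Kuhlmann2010, Section 2.2 and Section 5 (p. 18)] -/
theorem relRamificationIndex_eq_of_isGalois_prime {K M N : Subfield Ω} (hK : IsAlgClosed K)
    (hKM : K ≤ M) (h : M ≤ N) (hM : HenselianLocalRing (V.comap (algebraMap M Ω)))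
    (hresN : resField V N ≤ resField V K) (hfin : RelFinite M N h)
    (hgal : letI : Algebra M N := (Subfield.inclusion h).toAlgebra; IsGalois M N)
    {ℓ : ℕ} (hℓ : ℓ.Prime) (hℓv : (ℓ : ResidueField V) ≠ 0) (hdeg : relFinrank M N h = ℓ) :
    relRamificationIndex V M N h = ℓ := by
  classical
  letI : Algebra M N := (Subfield.inclusion h).toAlgebra
  haveI : IsScalarTower M N Ω := IsScalarTower.of_algebraMap_eq fun _ => rfl
  haveI : FiniteDimensional M N := hfin
  haveI : IsGalois M N := hgal
  haveI : Fact ℓ.Prime := ⟨hℓ⟩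
  have hfr : Module.finrank M N = ℓ := hdeg
  -- `ℓ ≠ 0` in `Ω`
  have hℓΩ : (ℓ : Ω) ≠ 0 := by
    intro h0
    apply hℓv
    have : ((ℓ : V) : Ω) = 0 := by simpa using h0
    have h1 : (ℓ : V) = 0 := Subtype.ext this
    have := congrArg (residue V) h1
    simpa using this
  -- the Galois group is cyclic of order `ℓ`, and `M` has the `ℓ`-th roots of unity: Kummer
  haveI : IsCyclic (N ≃ₐ[M] N) :=
    isCyclic_of_prime_card (p := ℓ) (by rw [IsGalois.card_aut_eq_finrank, hfr])
  obtain ⟨ζ, hζK, hζ⟩ := exists_isPrimitiveRoot_mem_of_isAlgClosed hK hℓΩ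
  have hprim : (primitiveRoots (Module.finrank M N) M).Nonempty := by
    refine ⟨⟨ζ, hKM hζK⟩, ?_⟩
    rw [hfr, mem_primitiveRoots hℓ.pos]
    exact IsPrimitiveRoot.of_map_of_injective (f := algebraMap M Ω) hζ Subtype.val_injective
  obtain ⟨α, hαℓ, hαtop⟩ := exists_root_adjoin_eq_top_of_isCyclic M N hprim
  rw [hfr] at hαℓ
  obtain ⟨b, hb⟩ := hαℓ
  set a : Ω := ((α : N) : Ω) with hadef
  have haN : a ∈ N := (α : N).2
  have habM : a ^ ℓ ∈ M := by
    have h1 : (((α ^ ℓ : N)) : Ω) = a ^ ℓ := by simp [hadef]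
    have h2 : ((algebraMap M N b : N) : Ω) = (b : Ω) := rfl
    rw [← h1, ← hb, h2]
    exact b.2
  -- `α ∉ M` (else `M⟮α⟯ = ⊥ ≠ ⊤`)
  have haM : a ∉ M := by
    intro haM
    have hbot : IntermediateField.adjoin M ({α} : Set N) = ⊥ := by
      rw [IntermediateField.adjoin_simple_eq_bot_iff]
      exact ⟨⟨a, haM⟩, Subtype.ext rfl⟩
    have h1 : Module.finrank M N = 1 := by
      rw [← IntermediateField.finrank_top', ← hαtop, hbot, IntermediateField.finrank_bot]
    rw [hfr] at h1
    exact hℓ.one_lt.ne' h1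
  have ha0 : a ≠ 0 := fun h0 => haM (h0 ▸ M.zero_mem)
  have hva : V.valuation a ≠ 0 := (_root_.map_ne_zero _).mpr ha0
  ---------------------------------------------------------------- `v(a) ∉ vM`
  have hnot : ∀ c ∈ M, c ≠ 0 → V.valuation a ≠ V.valuation c := by
    intro c hcM hc0 hac
    have hvc : V.valuation c ≠ 0 := (_root_.map_ne_zero _).mpr hc0
    -- `u = a/c` is a unit of `N` with residue in `Kv`
    set u : Ω := a / c with hudef
    have huN : u ∈ N := div_mem haN (h hcM)
    have hu1 : V.valuation u = 1 := by rw [hudef, map_div₀, hac, div_self hvc]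
    have huV : u ∈ V := (V.valuation_le_one_iff u).mp hu1.le
    have hures : residue V ⟨u, huV⟩ ∈ resField V K :=
      hresN ((mem_resField_iff V N _).mpr ⟨⟨u, huV⟩, huN, rfl⟩)
    obtain ⟨c', hc'K, hc'1, hu₁⟩ := exists_mem_valuation_div_sub_one_lt V hu1 hures
    have hc'0 : c' ≠ 0 := fun h0 => by rw [h0, map_zero] at hc'1; exact zero_ne_one hc'1
    set u₁ : Ω := u / c' with hu₁def
    have hu₁N : u₁ ∈ N := div_mem huN (h (hKM hc'K))
    have hvu₁ : V.valuation u₁ = 1 := by rw [hu₁def, map_div₀, hu1, hc'1, div_one]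
    have hu₁0 : u₁ ≠ 0 := fun h0 => by rw [h0, map_zero] at hvu₁; exact zero_ne_one hvu₁
    -- `b₁ = u₁^ℓ ∈ M` is a `1`-unit
    have hb₁M : u₁ ^ ℓ ∈ M := by
      rw [hu₁def, hudef, div_pow, div_pow]
      exact div_mem (div_mem habM (pow_mem hcM ℓ)) (pow_mem (hKM hc'K) ℓ)
    have hb₁ : V.valuation (u₁ ^ ℓ - 1) < 1 := by
      -- `u₁^ℓ - 1 = (u₁ - 1) · (∑ u₁^i)`, the second factor in `V`
      have hgeom : u₁ ^ ℓ - 1 = (u₁ - 1) * ∑ i ∈ Finset.range ℓ, u₁ ^ i :=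
        (mul_geom_sum u₁ ℓ).symm
      rw [hgeom, map_mul]
      have hs : V.valuation (∑ i ∈ Finset.range ℓ, u₁ ^ i) ≤ 1 := by
        refine Valuation.map_sum_le _ fun i _ => ?_
        rw [map_pow, hvu₁, one_pow]
      calc V.valuation (u₁ - 1) * V.valuation (∑ i ∈ Finset.range ℓ, u₁ ^ i)
          ≤ V.valuation (u₁ - 1) * 1 := mul_le_mul_right hs _
        _ < 1 := by rw [mul_one]; exact hu₁
    -- Hensel in `M`: `b₁ = d^ℓ`
    obtain ⟨d, hdM, hdℓ, hd1⟩ := exists_pow_eq_of_valuation_sub_one_lt V hM hℓv hb₁M hb₁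
    have hd0 : d ≠ 0 := by
      rintro rfl
      rw [zero_pow hℓ.ne_zero] at hdℓ
      exact pow_ne_zero ℓ hu₁0 hdℓ.symm
    -- `u₁/d` is an `ℓ`-th root of unity, hence in `K ≤ M`
    have hroot : (u₁ / d) ^ ℓ = 1 := by
      rw [div_pow, ← hdℓ, div_self (pow_ne_zero _ hd0)]
    have hζ₀ : u₁ / d ∈ M := hKM (mem_of_pow_eq_one_of_isAlgClosed hK hℓ.ne_zero hroot)
    -- unwind: `a = (u₁/d) · d · c' · c ∈ M`
    apply haM
    have : a = u₁ / d * d * c' * c := by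
      rw [hu₁def, hudef]
      field_simp
    rw [this]
    exact mul_mem (mul_mem (mul_mem hζ₀ hdM) (hKM hc'K)) hcM
  ---------------------------------------------------------------- `e = ℓ`
  set e := relRamificationIndex V M N h with hedef
  obtain ⟨he1, hf1⟩ := one_le_relRamificationIndex_and_relInertiaDegree (V := V) h hfin
  have hele : e ≤ ℓ := by
    have := relRamificationIndex_mul_relInertiaDegree_le (V := V) h hfin
    rw [hdeg] at this
    nlinarith
  obtain ⟨b₀, hb₀M, hb₀0, heb₀⟩ := exists_valuation_pow_relRamificationIndex_eq (V := V) h haN ha0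
  by_contra hne
  have hlt : e < ℓ := lt_of_le_of_ne hele hne
  -- `gcd(e, ℓ) = 1`, Bézout: `v(a) = v(b₀)^s · v(a^ℓ)^t ∈ vM`
  have hcop : IsCoprime (e : ℤ) (ℓ : ℤ) := by
    rw [Nat.isCoprime_iff_coprime]
    exact ((Nat.Prime.coprime_iff_not_dvd hℓ).mpr (Nat.not_dvd_of_pos_of_lt he1 hlt)).symm
  obtain ⟨s, t, hst⟩ := hcop
  have key : V.valuation a = V.valuation (b₀ ^ s * (a ^ ℓ) ^ t) := by
    rw [map_mul, map_zpow₀, map_zpow₀, map_pow, ← heb₀, ← zpow_natCast, ← zpow_natCast,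
      ← zpow_mul, ← zpow_mul, ← zpow_add₀ hva, mul_comm (e : ℤ) s, mul_comm (ℓ : ℤ) t, hst,
      zpow_one]
  exact hnot _ (mul_mem (zpow_mem hb₀M s) (zpow_mem habM t))
    (mul_ne_zero (zpow_ne_zero _ hb₀0) (zpow_ne_zero _ (pow_ne_zero _ ha0))) key

end TameStep

/-! ### Kuhlmann 2010, Lemma 2.27 (value-transcendental case) -/

section Lemma227

variable {V}

/-- **`e(N|M) = 1` if every value of `N` is a value of `M`.** [folklore] -/
theorem relRamificationIndex_eq_one_of_forall {M N : Subfield Ω} (h : M ≤ N)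
    (hv : ∀ a ∈ N, a ≠ 0 → ∃ b ∈ M, V.valuation a = V.valuation b) :
    relRamificationIndex V M N h = 1 := by
  letI : Algebra M N := (Subfield.inclusion h).toAlgebra
  set W : ValuationSubring N := V.comap (algebraMap N Ω) with hW
  unfold relRamificationIndex ramificationIndex
  rw [Subgroup.index_eq_one, eq_top_iff]
  intro γ _
  obtain ⟨z, hz⟩ := W.valuation_surjective (γ : W.ValueGroup)
  have hz0 : (z : Ω) ≠ 0 := by
    intro h0
    have : z = 0 := Subtype.ext h0
    rw [this, map_zero] at hz
    exact γ.ne_zero hz.symm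
  obtain ⟨b, hbM, hb⟩ := hv z z.2 hz0
  have hb0 : b ≠ 0 := by
    rintro rfl
    rw [map_zero, map_eq_zero] at hb
    exact hz0 hb
  refine (mem_valueSubgroup_iff M W γ).mpr ⟨⟨b, hbM⟩, fun h0 => hb0 (congrArg Subtype.val h0), ?_⟩
  rw [← hz]
  apply valueGroupHom_injective N V
  rw [valueGroupHom_valuation, valueGroupHom_valuation]
  exact hb

/-- **Kuhlmann 2010, Lemma 2.27, value-transcendental case**: "Take an algebraically closed field
`K` and a finite extension `(E|F,v)` within `F^r`. If `(F|K,v)` is a henselized rational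
function field with value-transcendental generator, then so is `(E|K,v)`. … *Proof.* Case I):
`(F|K,v)` has a value-transcendental generator `x`, so `F = K(x)^h`. Since
`vF = vK(x) = vK ⊕ ℤvx`, `vK` is divisible and `vE|vF` is finite, we have that
`vE = vK ⊕ ℤ(vx/n)` for some `n ≥ 1`. Since `E ⊂ F^r`, `n` is equal to `[E:F]` and prime to
`char K̄`. As `F̄ = K̄` is algebraically closed and `Ē|F̄` is finite, we find that `Ē = F̄`.
Therefore, Hensel's Lemma can be used to find an element `y` in the henselian field `E` such
that `y^n = cx` for some `c ∈ F` of value `0`. We have that `vy = vx/n`, `K(x)^h ⊂ K(y)^h`,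
`K(y)‾ = K(x)‾` and `[E:K(x)^h] ≥ [K(y)^h:K(x)^h] ≥ (vK(y):vK(x)) ≥ n = [E:K(x)^h]`. Hence,
equality holds everywhere, so `E = K(y)^h`." Rendering inside the algebraically closed
`(Ω, V)`, with `E ⊂ F^r` rendered by what the proof uses of it ("`n` is equal to `[E:F]` and
prime to `char K̄`", i.e. `E|F` is TAME: `[E : F] = (vE : vF)`, not divisible by the residue
characteristic — the classical characterization of the finite subextensions of the absolute
ramification field of a henselian field with algebraically closed residue field): `K ≤ Ω`
algebraically closed, `x` value-transcendental over `K`, `F = K(x)^h = henselizedAdjoin V K x`,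
`E ≥ F` finite with `[E : F] = e(E|F)` and `[E : F] ≠ 0` in `Ωv`; then `E = K(y)^h` for some
`y ∈ E` value-transcendental over `K`. PROVED from Hensel's Lemma for henselian fields
(`Kuhlmann2010HenselsLemma`, `HenselLift.lean`), with "the henselization is henselian /
immediate" (`HenselizationHenselian.lean`, `HenselizationImmediateProofs.lean`) and Lemma 2.5
(`GeneralizedStabilityLemma55VT.lean`): the element `x' ∈ E` with `v(x')^{n₀} ≡ v(x)` modulo
`vK` for the MAXIMAL admissible exponent `n₀` has `vE ⊆ vK·⟨vx'⟩` (the Bézout argument of the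
proof of Lemma 5.5); `n₀` divides `e(E|F) = [E : F]`, so it is prime to the residue
characteristic and Hensel's Lemma turns `x'` into `y ∈ E` with `y^{n₀} = c x`, `c ∈ K`; then
`F ≤ K(y)^h ≤ E`, `vE ⊆ vK·⟨vy⟩ ⊆ vK(y)^h`, and the tameness of `E|F` forces
`[E : K(y)^h] = 1`, whence `E = K(y)^h`.
[cite: Kuhlmann2010, Lemma 2.27] -/
theorem exists_eq_henselizedAdjoin_of_tame [IsAlgClosed Ω] (hHL : Kuhlmann2010HenselsLemma.{u})
    {K : Subfield Ω} (hK : IsAlgClosed K) {x : Ω} (hx : IsValueTranscendentalOver V K x)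
    {E : Subfield Ω} (hle : henselizedAdjoin V K x ≤ E) (hfin : RelFinite _ E hle)
    (htame : relRamificationIndex V (henselizedAdjoin V K x) E hle =
      relFinrank (henselizedAdjoin V K x) E hle)
    (hchar : ((relFinrank (henselizedAdjoin V K x) E hle : ℕ) : ResidueField V) ≠ 0) :
    ∃ y ∈ E, IsValueTranscendentalOver V K y ∧ E = henselizedAdjoin V K y := by
  classical
  have hH : Kuhlmann2010HenselizationIsHenselian.{u} := Kuhlmann2010HenselizationIsHenselian_holds
  have hI : Kuhlmann2010HenselizationImmediate.{u} := Kuhlmann2010HenselizationImmediate_holds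
  set Kx : Subfield Ω := (IntermediateField.adjoin K ({x} : Set Ω)).toSubfield with hKxdef
  set F' : Subfield Ω := henselizedAdjoin V K x with hF'def
  have hKKx : K ≤ Kx := fun c hc => (IntermediateField.adjoin K ({x} : Set Ω)).algebraMap_mem ⟨c, hc⟩
  have hxKx : x ∈ Kx := IntermediateField.subset_adjoin K ({x} : Set Ω) (Set.mem_singleton x)
  have hKxF' : Kx ≤ F' := adjoin_le_henselizedAdjoin V K x
  have hKE : K ≤ E := (le_henselizedAdjoin V K x).trans hle
  have hxE : x ∈ E := hle (mem_henselizedAdjoin_self V K x)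
  have hx0 : V.valuation x ≠ 0 := (_root_.map_ne_zero _).mpr hx.ne_zero
  -- `E` is henselian, algebraic over `K(x)`, with residue field `Kv`
  have halgF'E : ∀ a ∈ E, IsAlgebraic F' a := forall_isAlgebraic_of_relFinite hle hfin
  have hEhens : IsHenselianField E (V.comap (algebraMap E Ω)) :=
    isHenselianField_of_henselizedAdjoin_le hH hle halgF'E
  have hEH : HenselianLocalRing (V.comap (algebraMap E Ω)) := hHL E _ hEhens
  have halgE : ∀ a ∈ E, IsAlgebraic Kx a := fun a ha =>
    isAlgebraic_toSubfield_of_isAlgebraic (isAlgebraic_adjoin_of_relFinite hle hfin ha)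
  have hresE : resField V E ≤ resField V K :=
    resField_le_of_forall_isAlgebraic V hK (resField_adjoin_le hx) halgE
  ---------------------------------------------------------------- values of `E` (Lemma 2.1, 2.5)
  have hvalE : ∀ a ∈ E, a ≠ 0 → ∃ n : ℕ, 0 < n ∧ ∃ c ∈ K, c ≠ 0 ∧ ∃ m : ℤ,
      V.valuation a ^ n = V.valuation c * V.valuation x ^ m := by
    intro a ha ha0
    obtain ⟨n, hn, b, hb, hab⟩ := exists_valuation_pow_eq_of_isAlgebraic V (halgE a ha) ha0
    have hb0 : b ≠ 0 := by
      rintro rfl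
      rw [map_zero, map_pow, pow_eq_zero_iff hn, map_eq_zero] at hab
      exact ha0 hab
    obtain ⟨c, hc, m, hbc⟩ := exists_valuation_eq_of_mem_adjoin hx hb hb0
    have hc0 : c ≠ 0 := by
      rintro rfl
      rw [map_zero, zero_mul, map_eq_zero] at hbc
      exact hb0 hbc
    exact ⟨n, Nat.pos_of_ne_zero hn, c, hc, hc0, m, by rw [← map_pow, hab, hbc]⟩
  -- values of `F' = K(x)^h` are values of `K(x)`: `v(c) v(x)^k`
  have hvalF' : ∀ b ∈ F', b ≠ 0 → ∃ c ∈ K, c ≠ 0 ∧ ∃ k : ℤ,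
      V.valuation b = V.valuation c * V.valuation x ^ k := by
    intro b hb hb0
    obtain ⟨b₂, hb₂, hb₁₂⟩ := (hI Ω V Kx).1 b hb hb0
    have hb₂0 : b₂ ≠ 0 := by
      rintro rfl
      rw [map_zero, map_eq_zero] at hb₁₂
      exact hb0 hb₁₂
    obtain ⟨c', hc', k, hb₂c⟩ := exists_valuation_eq_of_mem_adjoin hx hb₂ hb₂0
    have hc'0 : c' ≠ 0 := by
      rintro rfl
      rw [map_zero, zero_mul, map_eq_zero] at hb₂c
      exact hb₂0 hb₂c
    exact ⟨c', hc', hc'0, k, by rw [hb₁₂, hb₂c]⟩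
  ---------------------------------------------------------------- the maximal exponent `n₀`
  let P : ℕ → Prop := fun n => 0 < n ∧ ∃ a ∈ E, a ≠ 0 ∧ ∃ c ∈ K, c ≠ 0 ∧
    V.valuation a ^ n = V.valuation c * V.valuation x
  have hP1 : P 1 := ⟨one_pos, x, hxE, hx.ne_zero, 1, K.one_mem, one_ne_zero,
    by rw [pow_one, map_one, one_mul]⟩
  set e := relRamificationIndex V F' E hle with hedef
  have he1 : 1 ≤ e := (one_le_relRamificationIndex_and_relInertiaDegree hle hfin).1
  -- an admissible exponent divides `e`
  have hPdvd : ∀ n, P n → n ∣ e := by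
    rintro n ⟨hn, a, ha, ha0, c, hc, hc0, hac⟩
    obtain ⟨b₁, hb₁, hb₁0, hab₁⟩ := exists_valuation_pow_relRamificationIndex_eq hle ha ha0
    obtain ⟨c', hc', hc'0, k, hb₁c⟩ := hvalF' b₁ hb₁ hb₁0
    have hvc : V.valuation c ≠ 0 := (_root_.map_ne_zero _).mpr hc0
    have hvc' : V.valuation c' ≠ 0 := (_root_.map_ne_zero _).mpr hc'0
    -- `v(a)^(n e)` computed in two ways
    have h1 : V.valuation a ^ (n * e) = V.valuation c ^ e * V.valuation x ^ (e : ℤ) := by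
      rw [pow_mul, hac, mul_pow, zpow_natCast]
    have h2 : V.valuation a ^ (n * e) = V.valuation c' ^ n * V.valuation x ^ (k * n) := by
      rw [mul_comm n e, pow_mul, hedef, hab₁, hb₁c, mul_pow, ← zpow_natCast (V.valuation x ^ k) n,
        ← zpow_mul]
    by_cases heq : (e : ℤ) = k * n
    · exact Int.natCast_dvd_natCast.mp ⟨k, by rw [heq, mul_comm]⟩
    · exfalso
      have key : V.valuation x ^ ((e : ℤ) - k * n) = V.valuation (c' ^ n / c ^ e) := by
        rw [zpow_sub₀ hx0, map_div₀, map_pow, map_pow,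
          div_eq_div_iff (zpow_ne_zero _ hx0) (pow_ne_zero _ hvc)]
        calc V.valuation x ^ (e : ℤ) * V.valuation c ^ e
            = V.valuation c ^ e * V.valuation x ^ (e : ℤ) := mul_comm _ _
          _ = V.valuation a ^ (n * e) := h1.symm
          _ = V.valuation c' ^ n * V.valuation x ^ (k * n) := h2
      exact hx.zpow_ne (sub_ne_zero.mpr heq) (div_mem (pow_mem hc' n) (pow_mem hc e)) key
  have hPbound : ∀ n, P n → n ≤ e := fun n hn => Nat.le_of_dvd he1 (hPdvd n hn)
  obtain ⟨hn₀pos, x', hx'E, hx'0, c₀, hc₀, hc₀0, hstar⟩ :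
      P (Nat.findGreatest P e) := Nat.findGreatest_spec he1 hP1
  set n₀ := Nat.findGreatest P e with hn₀def
  have hmax : ∀ n, P n → n ≤ n₀ := fun n hn => Nat.le_findGreatest (hPbound n hn) hn
  have hn₀dvd : n₀ ∣ e := hPdvd n₀ ⟨hn₀pos, x', hx'E, hx'0, c₀, hc₀, hc₀0, hstar⟩
  have hX'0 : V.valuation x' ≠ 0 := (_root_.map_ne_zero _).mpr hx'0
  have hvc₀ : V.valuation c₀ ≠ 0 := (_root_.map_ne_zero _).mpr hc₀0
  ---------------------------------------------------------------- `vE ⊆ vK·⟨v x'⟩`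
  have hvalx' : ∀ b ∈ E, b ≠ 0 → ∃ c ∈ K, ∃ M : ℤ,
      V.valuation b = V.valuation c * V.valuation x' ^ M := by
    intro b hb hb0
    have hvb : V.valuation b ≠ 0 := (_root_.map_ne_zero _).mpr hb0
    obtain ⟨n, hn, c₁, hc₁, hc₁0, m, hbn⟩ := hvalE b hb hb0
    have hvc₁ : V.valuation c₁ ≠ 0 := (_root_.map_ne_zero _).mpr hc₁0
    have hvx : V.valuation x = V.valuation x' ^ (n₀ : ℤ) * (V.valuation c₀)⁻¹ := by
      rw [zpow_natCast, hstar, mul_comm (V.valuation c₀), mul_inv_cancel_right₀ hvc₀]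
    have hc₂ : c₁ * c₀ ^ (-m) ∈ K := mul_mem hc₁ (zpow_mem hc₀ _)
    have hc₂0 : c₁ * c₀ ^ (-m) ≠ 0 := mul_ne_zero hc₁0 (zpow_ne_zero _ hc₀0)
    have hbn' : V.valuation b ^ (n : ℤ) = V.valuation (c₁ * c₀ ^ (-m)) * V.valuation x' ^ ((n₀ : ℤ) * m) := by
      rw [zpow_natCast, hbn, hvx, mul_zpow, ← zpow_mul, inv_zpow', map_mul, map_zpow₀]
      ac_rfl
    have hgpos : 0 < Int.gcd (n : ℤ) ((n₀ : ℤ) * m) :=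
      Int.gcd_pos_of_ne_zero_left _ (by exact_mod_cast hn.ne')
    obtain ⟨g, n', M', hg, hcop, hn', hM'⟩ := Int.exists_gcd_one' hgpos
    have hcop' : IsCoprime n' M' := Int.isCoprime_iff_gcd_eq_one.mpr hcop
    have hn'pos : 0 < n' := by
      have h0 : (0 : ℤ) < n' * g := by rw [← hn']; exact_mod_cast hn
      nlinarith [h0, hg]
    have key1 : V.valuation (b ^ n' * x' ^ (-M')) ^ g = V.valuation (c₁ * c₀ ^ (-m)) := by
      rw [map_mul, map_zpow₀, map_zpow₀, mul_pow, ← zpow_natCast (V.valuation b ^ n') g,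
        ← zpow_natCast (V.valuation x' ^ (-M')) g, ← zpow_mul, ← zpow_mul, ← hn', neg_mul, ← hM',
        hbn', mul_assoc, ← zpow_add₀ hX'0, add_neg_cancel, zpow_zero, mul_one]
    obtain ⟨c₃, hc₃, hc₃eq⟩ :=
      exists_valuation_eq_of_pow_eq_of_isAlgClosed_subfield hK hc₂ (Nat.pos_iff_ne_zero.mp hg) key1
    have hc₃0 : c₃ ≠ 0 := by
      rintro rfl
      rw [map_zero, map_eq_zero] at hc₃eq
      exact mul_ne_zero (zpow_ne_zero _ hb0) (zpow_ne_zero _ hx'0) hc₃eq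
    have h2 : V.valuation b ^ n' = V.valuation c₃ * V.valuation x' ^ M' := by
      rw [map_mul, map_zpow₀, map_zpow₀, zpow_neg, mul_inv_eq_iff_eq_mul₀ (zpow_ne_zero _ hX'0)]
        at hc₃eq
      exact hc₃eq
    obtain ⟨u, w, hz⟩ := exists_zpow_mul_zpow_pow_eq hX'0 hcop' h2
    have hzval : V.valuation (x' ^ u * b ^ w) ^ n' = V.valuation c₃ ^ w * V.valuation x' := by
      rw [map_mul, map_zpow₀, map_zpow₀]; exact hz
    have hPbig : P (n'.toNat * n₀) := by
      refine ⟨Nat.mul_pos (by omega) hn₀pos, x' ^ u * b ^ w,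
        mul_mem (zpow_mem hx'E u) (zpow_mem hb w),
        mul_ne_zero (zpow_ne_zero _ hx'0) (zpow_ne_zero _ hb0), c₃ ^ (w * n₀) * c₀,
        mul_mem (zpow_mem hc₃ _) hc₀, mul_ne_zero (zpow_ne_zero _ hc₃0) hc₀0, ?_⟩
      rw [pow_mul, ← zpow_natCast (V.valuation (x' ^ u * b ^ w)) n'.toNat,
        Int.toNat_of_nonneg hn'pos.le, hzval, mul_pow, hstar, map_mul, map_zpow₀,
        ← zpow_natCast (V.valuation c₃ ^ w) n₀, ← zpow_mul, mul_assoc]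
    have hle' : n'.toNat * n₀ ≤ n₀ := hmax _ hPbig
    have hn'1 : n' = 1 := by
      have h1 : n'.toNat * n₀ ≤ 1 * n₀ := by rwa [one_mul]
      have h3 : n'.toNat ≤ 1 := Nat.le_of_mul_le_mul_right h1 hn₀pos
      omega
    rw [hn'1, zpow_one] at h2
    exact ⟨c₃, hc₃, M', h2⟩
  ---------------------------------------------------------------- Hensel: `y ∈ E` with `y^{n₀} = c₂ x`
  -- `n₀ ≠ 0` in the residue field (it divides `e = [E : F]`)
  have hn₀char : ((n₀ : ℕ) : ResidueField V) ≠ 0 := by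
    intro h0
    apply hchar
    rw [← htame]
    obtain ⟨k, hk⟩ := hn₀dvd
    rw [hk, Nat.cast_mul, h0, zero_mul]
  -- the unit `u = x'^{n₀} / (c₀ x)` of `E`
  set u : Ω := x' ^ n₀ / (c₀ * x) with hudef
  have huE : u ∈ E := div_mem (pow_mem hx'E _) (mul_mem (hKE hc₀) hxE)
  have hu1 : V.valuation u = 1 := by
    rw [hudef, map_div₀, map_pow, hstar, map_mul, div_self (mul_ne_zero hvc₀ hx0)]
  have huV : u ∈ V := (V.valuation_le_one_iff u).mp hu1.le
  have hures : residue V ⟨u, huV⟩ ∈ resField V K :=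
    hresE ((mem_resField_iff V E _).mpr ⟨⟨u, huV⟩, huE, rfl⟩)
  obtain ⟨c', hc'K, hc'1, hu₁⟩ := exists_mem_valuation_div_sub_one_lt V hu1 hures
  have hc'0 : c' ≠ 0 := fun h0 => by rw [h0, map_zero] at hc'1; exact zero_ne_one hc'1
  obtain ⟨w, hwE, hwn, hw1⟩ :=
    exists_pow_eq_of_valuation_sub_one_lt V hEH hn₀char (div_mem huE (hKE hc'K)) hu₁
  have hvw : V.valuation w = 1 := by
    have h := Valuation.map_add_eq_of_lt_left V.valuation (x := (1 : Ω)) (y := w - 1)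
      (by rw [Valuation.map_one]; exact hw1)
    rw [add_sub_cancel, Valuation.map_one] at h
    exact h
  have hw0 : w ≠ 0 := fun h0 => by rw [h0, map_zero] at hvw; exact zero_ne_one hvw
  set y : Ω := x' / w with hydef
  have hyE : y ∈ E := div_mem hx'E hwE
  set c₂ : Ω := c₀ * c' with hc₂def
  have hc₂K : c₂ ∈ K := mul_mem hc₀ hc'K
  have hc₂0 : c₂ ≠ 0 := mul_ne_zero hc₀0 hc'0
  have hypow : y ^ n₀ = c₂ * x := by
    rw [hydef, div_pow, hwn, hudef, hc₂def]
    field_simp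
  have hy0 : y ≠ 0 := div_ne_zero hx'0 hw0
  have hvy : V.valuation y = V.valuation x' := by rw [hydef, map_div₀, hvw, div_one]
  have hystar : V.valuation y ^ n₀ = V.valuation c₂ * V.valuation x := by
    rw [← map_pow, hypow, map_mul]
  ---------------------------------------------------------------- `y` is value-transcendental
  have hy : IsValueTranscendentalOver V K y := by
    intro n hn c hc h
    have hvc₂ : V.valuation c₂ ≠ 0 := (_root_.map_ne_zero _).mpr hc₂0
    apply hx n hn (c ^ n₀ / c₂ ^ n) (div_mem (pow_mem hc _) (pow_mem hc₂K _))
    have : (V.valuation c₂ * V.valuation x) ^ n = V.valuation c ^ n₀ := by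
      rw [← hystar, ← pow_mul, mul_comm n₀ n, pow_mul, h]
    rw [map_div₀, map_pow, map_pow, eq_div_iff (pow_ne_zero _ hvc₂), ← this, mul_pow, mul_comm]
  ---------------------------------------------------------------- `F' ≤ K(y)^h ≤ E`
  set Ky : Subfield Ω := (IntermediateField.adjoin K ({y} : Set Ω)).toSubfield with hKydef
  set F'' : Subfield Ω := henselizedAdjoin V K y with hF''def
  have hKKy : K ≤ Ky := fun c hc => (IntermediateField.adjoin K ({y} : Set Ω)).algebraMap_mem ⟨c, hc⟩
  have hyKy : y ∈ Ky := IntermediateField.subset_adjoin K ({y} : Set Ω) (Set.mem_singleton y)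
  have hKyE : Ky ≤ E := by
    rw [hKydef, adjoin_toSubfield_eq_closure]
    exact Subfield.closure_le.mpr (Set.union_subset hKE (Set.singleton_subset_iff.mpr hyE))
  have hF''E : F'' ≤ E := henselization_le_of_isHenselianField V Ky hKyE hEhens
  have hxKy : x ∈ Ky := by
    have : x = y ^ n₀ / c₂ := by rw [hypow]; field_simp
    rw [this]
    exact div_mem (pow_mem hyKy _) (hKKy hc₂K)
  have hKxKy : Kx ≤ Ky := by
    rw [hKxdef, adjoin_toSubfield_eq_closure]
    exact Subfield.closure_le.mpr (Set.union_subset (fun c hc => hKKy hc)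
      (Set.singleton_subset_iff.mpr hxKy))
  have hF'F'' : F' ≤ F'' := henselization_mono V hH hKxKy
  ---------------------------------------------------------------- the squeeze: `E = K(y)^h`
  have hvalF'' : ∀ b ∈ E, b ≠ 0 → ∃ b' ∈ F'', V.valuation b = V.valuation b' := by
    intro b hb hb0
    obtain ⟨c, hc, M, hbM⟩ := hvalx' b hb hb0
    refine ⟨c * y ^ M, mul_mem ((le_henselizedAdjoin V K y) hc)
      (zpow_mem (mem_henselizedAdjoin_self V K y) M), ?_⟩
    rw [hbM, map_mul, map_zpow₀, hvy]
  have heF''E : relRamificationIndex V F'' E hF''E = 1 :=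
    relRamificationIndex_eq_one_of_forall hF''E hvalF''
  -- degrees and ramification indices in the tower `F' ≤ F'' ≤ E`
  have htow := rel_tower (V := V) hF'F'' hF''E
  have htowe : relRamificationIndex V F' E hle =
      relRamificationIndex V F' F'' hF'F'' * relRamificationIndex V F'' E hF''E := htow.1
  have htown : relFinrank F' E hle = relFinrank F' F'' hF'F'' * relFinrank F'' E hF''E := htow.2.2
  have hfinF'' : RelFinite F'' E hF''E := ((relFinite_tower_iff hF'F'' hF''E).mp hfin).2
  have hfinF' : RelFinite F' F'' hF'F'' := ((relFinite_tower_iff hF'F'' hF''E).mp hfin).1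
  have hfund := relRamificationIndex_mul_relInertiaDegree_le (V := V) hF'F'' hfinF'
  obtain ⟨-, hf1⟩ := one_le_relRamificationIndex_and_relInertiaDegree (V := V) hF'F'' hfinF'
  have hn1 : 1 ≤ relFinrank F'' E hF''E := one_le_relFinrank hF''E hfinF''
  -- `[E : F''] = 1`
  have hdeg1 : relFinrank F'' E hF''E = 1 := by
    have h1 : relRamificationIndex V F' E hle = relRamificationIndex V F' F'' hF'F'' := by
      rw [htowe, heF''E, mul_one]
    have h1' : relRamificationIndex V F' F'' hF'F'' ≤ relFinrank F' F'' hF'F'' := by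
      nlinarith
    -- `[F'' : F'][E : F''] = [E : F'] = e(E|F') = e(F''|F') ≤ [F'' : F']`
    have h2 : relFinrank F' F'' hF'F'' * relFinrank F'' E hF''E ≤ relFinrank F' F'' hF'F'' * 1 := by
      rw [mul_one, ← htown, ← htame, hedef, h1]
      exact h1'
    have h3 : 0 < relFinrank F' F'' hF'F'' := one_le_relFinrank hF'F'' hfinF'
    have := Nat.le_of_mul_le_mul_left h2 h3
    omega
  have hEq : E = F'' := by
    letI : Algebra F'' E := (Subfield.inclusion hF''E).toAlgebra
    haveI : FiniteDimensional F'' E := hfinF''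
    have hdeg1' : Module.finrank F'' E = 1 := hdeg1
    have hbot : (⊥ : Subalgebra F'' E) = ⊤ :=
      Subalgebra.bot_eq_top_iff_finrank_eq_one.mpr hdeg1'
    refine le_antisymm (fun b hb => ?_) hF''E
    have hmem : (⟨b, hb⟩ : E) ∈ (⊥ : Subalgebra F'' E) := hbot ▸ Algebra.mem_top
    obtain ⟨c, hc⟩ := Algebra.mem_bot.mp hmem
    have : (c : Ω) = b := congrArg Subtype.val hc
    rw [← this]
    exact c.2
  exact ⟨y, hyE, hy, hEq⟩

end Lemma227

end Literature.AlgebraicGeometry.Resolution
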